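import Summits.QuantumFields.BalabanUV.Beta.EriceRemainderEnclosureHistoryAutonomyComparisonTowerUniform

/-!
# EriceRemainderEnclosureHistoryAutonomyComparisonTwoAgesMarkov — (E63d) ANY TWO AFFINE AGES WITH ANY MARKOV WEIGHT COMPARE AT ANY SIZE:
# `B(u) = b + L_0·u_0 + L₁·u_{k₁} + L₂·u_{k₂}` (`b > 0`, `1 ≤ k₁ ≠ k₂`, ALL THREE SIZES `L_0, L₁, L₂ ≥ 0` ARBITRARY) and every `B′ ≥ B` with a zeroth
# moment and an ISOTONE excess: ANY box solutions from one pin satisfy `h′ ≤ h` at every scale — NEAR ages (ratio `≤ 36`) by (E58b)'s profile condition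
# (the Markov weight only enlarges every `P_j`; the two-age quadratic form certified up to ratio `36` instead of (E59e)'s `21`), FAR ages (ratio `≥ 36`) by
# (E63c)'s uniform tower theorem with a Markov rider — which needs (E63a)'s a priori drop bound: (E59d)∕(E62b) carried no rider

Cell `pub-balaban`, β-function sub-cell, BINDER row D4 «RemainderConst leaves for Bałaban's split» (`HOME/BINDER-OWNERS.md`; owner lineage `b2b-balaban-beta-an4`;
this file by co-owner #2 lineage `b2b-balaban-beta-d4-p2`, generation 56), β-FLOW TEAM duty (1), FREEZE (0) honoured (def-free; (E63c)'s
`le_of_isotone_excess_tower_ratio_uniform`, (E58b)'s `le_of_isotone_excess_affine_profile`, (E62a)'s `one_sub_sqrt_two_div_two_bounds`, Mathlib's `Finset.card_pair` ∕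
`Finset.sum_pair` BY NAME; nothing restated).  Sequel of (E59e) `…ComparisonTwoAges` (two ages, no Markov weight) and (E63c) `…ComparisonTowerUniform`.

HONEST FRAMING (page 1, verbatim and binding).  *"Discharging BetaPertH makes Bałaban's UV stability UNCONDITIONAL — a real constructive-QFT result; it is
NOT the continuum limit and NOT the Clay problem."*  THIS FILE DISCHARGES NOTHING OF THE KIND.  Elementary real analysis about ABSTRACT affine functionals on
a box ]0,γ]^ℕ with displayed supports and signs — hypotheses of a census, not facts; the form, signs, ages and moments of Bałaban's (1.22) limit functional
are NOT PRINTED ([I] p. 298; GAPS G-t4-U2-1∕-2) and NOT asserted.  Row D4 class UNCHANGED (critical-path width 0; instance 0∕1; D4 DISCHARGE NO DATE).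
HONEST DEPENDENCY: continuum YM on T⁴ ⇐ BetaPertH ∧ nine spine estimates (0/9 proved); BetaPertH ⇐ (D1) ∧ (D4) ∧ CAP+tail; G-an2-4 gates asym, D1 and
NE2/3/4.

THE POINT (census sense (α); the COMPARISON column, conjecture (E58′)).  (E59e) settled ANY two ages `k₁ ≠ k₂` without a Markov weight: near pairs
(ratio `≤ 21`) pass (E58b)'s profile condition, far pairs (ratio `≥ 21`) by (E59d)'s peeling.  With a Markov weight `L_0` the near half only improves —
`P_j` gains the summand `L_0·√(j∕j) = L_0` and the `j = 0` summand of the profile sum reads `0` (§1 `profileSum_le_two_of_two_ages_markov`; the two-age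
quadratic form `(√2−1)s′L₁² + (1 + 2ss′ − √2)L₁L₂ + (√2−1)sL₂² ≥ 0` is certified here up to ratio `36` from `s, s′ ≥ √(1∕37)` and `2ss′ ≥ 12∕37`, §1
`two_sqrt_prod_ge_of_ratio_le`, `sqrt_ratio_ge`) — but the far half needs a peeling theorem that tolerates the rider's drops at every deeper scale: (E63c)
`le_of_isotone_excess_tower_ratio_uniform` with `n = 2`, `R = 36` (§2).  §3 assembles: **ANY two ages with ANY Markov weight compare at any size**
(`le_of_isotone_excess_two_ages_markov`).  NOT CLAIMED: three ages at intermediate ratios; anything printed.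

WHAT IS PROVED ([folklore]; 0 `def`, 0 sorry).  §1 `two_sqrt_prod_ge_of_ratio_le`, `sqrt_ratio_ge`, **`profileSum_le_two_of_two_ages_markov`**,
`le_of_isotone_excess_two_ages_markov_near`.  §2 `le_of_isotone_excess_two_ages_markov_far`.  §3 **`le_of_isotone_excess_two_ages_markov`**.
-/
noncomputable section
open Finset Set

namespace Summit.QuantumFields.BalabanUV.Beta.EriceRemainderEnclosureHistoryAutonomyComparisonTwoAgesMarkov

open Literature.MathematicalPhysics.QuantumFieldTheory.Balaban1983to89
open Literature.MathematicalPhysics.QuantumFieldTheory.Balaban1983to89.T4BetaStationary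
open Literature.MathematicalPhysics.QuantumFieldTheory.Balaban1983to89.T4BetaFlowWellPosed
open Summit.QuantumFields.BalabanUV.Beta.EriceRemainderEnclosureHistoryAutonomyComparisonAffineProfile (le_of_isotone_excess_affine_profile)
open Summit.QuantumFields.BalabanUV.Beta.EriceRemainderEnclosureHistoryAutonomyComparisonTowerLemmas (one_sub_sqrt_two_div_two_bounds)
open Summit.QuantumFields.BalabanUV.Beta.EriceRemainderEnclosureHistoryAutonomyComparisonTowerUniform (le_of_isotone_excess_tower_ratio_uniform)

variable {B' : (ℕ → ℝ) → ℝ} {M' γ b : ℝ} {L : ℕ → ℝ} {K k₁ k₂ : ℕ} {h h' : ℕ → ℝ}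

/-! ## §1 Two ages with ratio at most 36 and a Markov rider pass the profile condition -/

/-- For `1 ≤ k₁, k₂` with `k₂ ≤ 36·k₁` and `k₁ ≤ 36·k₂`: `2·√(k₁∕(k₁+k₂))·√(k₂∕(k₂+k₁)) ≥ 0.3243` — from
`1369·4k₁k₂ − 144(k₁+k₂)² = 4(36k₁ − k₂)(36k₂ − k₁) ≥ 0`. [folklore] -/
theorem two_sqrt_prod_ge_of_ratio_le (hk₁ : 1 ≤ k₁) (hk₂ : 1 ≤ k₂) (h12 : k₂ ≤ 36 * k₁) (h21 : k₁ ≤ 36 * k₂) :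
    0.3243 ≤ 2 * (Real.sqrt ((k₁ : ℝ) / ((k₁ : ℝ) + k₂)) * Real.sqrt ((k₂ : ℝ) / ((k₂ : ℝ) + k₁))) := by
  have hk₁r : (1 : ℝ) ≤ k₁ := by exact_mod_cast hk₁
  have hk₂r : (1 : ℝ) ≤ k₂ := by exact_mod_cast hk₂
  have h12r : (k₂ : ℝ) ≤ 36 * k₁ := by exact_mod_cast h12
  have h21r : (k₁ : ℝ) ≤ 36 * k₂ := by exact_mod_cast h21
  have hS : (0 : ℝ) < (k₁ : ℝ) + k₂ := by linarith
  set σ : ℝ := 2 * (Real.sqrt ((k₁ : ℝ) / ((k₁ : ℝ) + k₂)) * Real.sqrt ((k₂ : ℝ) / ((k₂ : ℝ) + k₁))) with hσ_def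
  have hσ0 : 0 ≤ σ := by positivity
  have hσsq : σ * σ = 4 * ((k₁ : ℝ) * k₂) / (((k₁ : ℝ) + k₂) * ((k₁ : ℝ) + k₂)) := by
    rw [hσ_def, show (k₂ : ℝ) + k₁ = (k₁ : ℝ) + k₂ by ring]
    have e1 := Real.mul_self_sqrt (div_nonneg (by linarith : (0 : ℝ) ≤ k₁) hS.le)
    have e2 := Real.mul_self_sqrt (div_nonneg (by linarith : (0 : ℝ) ≤ k₂) hS.le)
    calc 2 * (Real.sqrt ((k₁ : ℝ) / ((k₁ : ℝ) + k₂)) * Real.sqrt ((k₂ : ℝ) / ((k₁ : ℝ) + k₂))) *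
          (2 * (Real.sqrt ((k₁ : ℝ) / ((k₁ : ℝ) + k₂)) * Real.sqrt ((k₂ : ℝ) / ((k₁ : ℝ) + k₂))))
        = 4 * ((Real.sqrt ((k₁ : ℝ) / ((k₁ : ℝ) + k₂)) * Real.sqrt ((k₁ : ℝ) / ((k₁ : ℝ) + k₂))) *
            (Real.sqrt ((k₂ : ℝ) / ((k₁ : ℝ) + k₂)) * Real.sqrt ((k₂ : ℝ) / ((k₁ : ℝ) + k₂)))) := by ring
      _ = 4 * (((k₁ : ℝ) / ((k₁ : ℝ) + k₂)) * ((k₂ : ℝ) / ((k₁ : ℝ) + k₂))) := by rw [e1, e2]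
      _ = 4 * ((k₁ : ℝ) * k₂) / (((k₁ : ℝ) + k₂) * ((k₁ : ℝ) + k₂)) := by field_simp
  have hlow : 144 / 1369 ≤ σ * σ := by
    rw [hσsq, le_div_iff₀ (by positivity)]
    nlinarith [mul_nonneg (by linarith : (0 : ℝ) ≤ 36 * k₁ - k₂) (by linarith : (0 : ℝ) ≤ 36 * k₂ - k₁)]
  nlinarith [mul_nonneg hσ0 hσ0, hlow]

/-- For `1 ≤ k₁` and `k₂ ≤ 36·k₁`: `√(k₁∕(k₁+k₂)) ≥ 0.1643` (`k₁∕(k₁+k₂) ≥ 1∕37`). [folklore] -/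
theorem sqrt_ratio_ge (hk₁ : 1 ≤ k₁) (h12 : k₂ ≤ 36 * k₁) : 0.1643 ≤ Real.sqrt ((k₁ : ℝ) / ((k₁ : ℝ) + k₂)) := by
  have hk₁r : (1 : ℝ) ≤ k₁ := by exact_mod_cast hk₁
  have h12r : (k₂ : ℝ) ≤ 36 * k₁ := by exact_mod_cast h12
  have hk₂r : (0 : ℝ) ≤ k₂ := Nat.cast_nonneg _
  have hS : (0 : ℝ) < (k₁ : ℝ) + k₂ := by linarith
  have hx : (0.1643 : ℝ) ^ 2 ≤ (k₁ : ℝ) / ((k₁ : ℝ) + k₂) := by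
    rw [le_div_iff₀ hS]; nlinarith
  calc (0.1643 : ℝ) = Real.sqrt (0.1643 ^ 2) := by rw [Real.sqrt_sq (by norm_num)]
    _ ≤ Real.sqrt ((k₁ : ℝ) / ((k₁ : ℝ) + k₂)) := Real.sqrt_le_sqrt hx
set_option maxHeartbeats 400000 in
/-- **TWO AGES WITH RATIO AT MOST 36 AND ANY MARKOV WEIGHT PASS THE PROFILE CONDITION**: `L ≥ 0` supported on `{0, k₁, k₂}`, `1 ≤ k₁ ≠ k₂ < K`,
`k₂ ≤ 36k₁`, `k₁ ≤ 36k₂` ⟹ `Σ_{j<K} L_j ∕ P_j ≤ 2`, `P_j = Σ_{k<K} L_k·√(j∕(j+k))` — the `j = 0` summand reads `0` (`P_0 = 0`), the Markov weight enlarges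
`P_{k₁}`, `P_{k₂}` by `L_0`, and the remaining two-age form is `≥ [(1 + 2ss′ − √2) + 2(√2−1)·0.1643]·L₁L₂ ≥ 0`. [folklore] -/
theorem profileSum_le_two_of_two_ages_markov (hL : ∀ k, 0 ≤ L k) (hk₁ : 1 ≤ k₁) (hk₂ : 1 ≤ k₂) (hne : k₁ ≠ k₂) (hk₁K : k₁ ∈ range K)
    (hk₂K : k₂ ∈ range K) (h12 : k₂ ≤ 36 * k₁) (h21 : k₁ ≤ 36 * k₂) (hsupp : ∀ k ∈ range K, k ≠ 0 → k ≠ k₁ → k ≠ k₂ → L k = 0) :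
    ∑ j ∈ range K, L j / ∑ k ∈ range K, L k * Real.sqrt ((j : ℝ) / ((j : ℝ) + k)) ≤ 2 := by
  have hk₁r : (1 : ℝ) ≤ k₁ := by exact_mod_cast hk₁
  have hk₂r : (1 : ℝ) ≤ k₂ := by exact_mod_cast hk₂
  set P : ℕ → ℝ := fun j => ∑ k ∈ range K, L k * Real.sqrt ((j : ℝ) / ((j : ℝ) + k)) with hP_def
  have hP0 : ∀ j, 0 ≤ P j := fun j => sum_nonneg fun k _ => mul_nonneg (hL k) (Real.sqrt_nonneg _)
  -- the outer sum lives on {k₁, k₂}: the j = 0 summand has P_0 = 0, the other ages carry no weight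
  have hpair : ({k₁, k₂} : Finset ℕ) ⊆ range K := by
    intro j hj; simp only [Finset.mem_insert, Finset.mem_singleton] at hj; rcases hj with rfl | rfl <;> assumption
  have hout : ∑ j ∈ range K, L j / P j = L k₁ / P k₁ + L k₂ / P k₂ := by
    rw [← sum_pair (f := fun j => L j / P j) hne]
    refine (sum_subset hpair fun j hj hjA => ?_).symm
    simp only [Finset.mem_insert, Finset.mem_singleton, not_or] at hjA
    rcases Nat.eq_zero_or_pos j with rfl | hjpos
    · have : P 0 = 0 := by
        simp only [hP_def]; exact sum_eq_zero fun k _ => by rw [Nat.cast_zero, zero_div, Real.sqrt_zero, mul_zero]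
      rw [this, div_zero]
    · rw [hsupp j hj (Nat.pos_iff_ne_zero.mp hjpos) hjA.1 hjA.2, zero_div]
  -- P_{k₁} ≥ L₁ρ + L₂ s, P_{k₂} ≥ L₁ s′ + L₂ ρ (the Markov weight and everything else only add)
  have hPge : ∀ j : ℕ, L k₁ * Real.sqrt ((j : ℝ) / ((j : ℝ) + k₁)) + L k₂ * Real.sqrt ((j : ℝ) / ((j : ℝ) + k₂)) ≤ P j := by
    intro j
    rw [← sum_pair (f := fun k => L k * Real.sqrt ((j : ℝ) / ((j : ℝ) + k))) hne]
    exact sum_le_sum_of_subset_of_nonneg hpair fun k _ _ => mul_nonneg (hL k) (Real.sqrt_nonneg _)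
  have hP₁ : L k₁ * Real.sqrt (1 / 2) + L k₂ * Real.sqrt ((k₁ : ℝ) / ((k₁ : ℝ) + k₂)) ≤ P k₁ := by
    have := hPge k₁; rwa [show (k₁ : ℝ) / ((k₁ : ℝ) + k₁) = 1 / 2 by field_simp; ring] at this
  have hP₂ : L k₁ * Real.sqrt ((k₂ : ℝ) / ((k₂ : ℝ) + k₁)) + L k₂ * Real.sqrt (1 / 2) ≤ P k₂ := by
    have := hPge k₂; rwa [show (k₂ : ℝ) / ((k₂ : ℝ) + k₂) = 1 / 2 by field_simp; ring] at this
  -- the two reads of each age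
  set s : ℝ := Real.sqrt ((k₁ : ℝ) / ((k₁ : ℝ) + k₂)) with hs_def
  set s' : ℝ := Real.sqrt ((k₂ : ℝ) / ((k₂ : ℝ) + k₁)) with hs'_def
  set ρ : ℝ := Real.sqrt (1 / 2) with hρ_def
  have hρ0 : 0 < ρ := Real.sqrt_pos.mpr (by norm_num)
  have hρsq : ρ * ρ = 1 / 2 := Real.mul_self_sqrt (by norm_num)
  have hs0 : 0.1643 ≤ s := sqrt_ratio_ge hk₁ h12
  have hs'0 : 0.1643 ≤ s' := sqrt_ratio_ge hk₂ h21
  have hσ := two_sqrt_prod_ge_of_ratio_le hk₁ hk₂ h12 h21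
  rw [← hs_def, ← hs'_def] at hσ
  have h2ρ_hi : 2 * ρ < 1.4143 := by nlinarith
  have h2ρ_lo : 1.4142 ≤ 2 * ρ := by nlinarith
  rw [hout]
  -- degenerate cases
  rcases (hL k₁).eq_or_lt with hL₁ | hL₁
  · rw [← hL₁, zero_div, zero_add]
    rcases (hL k₂).eq_or_lt with hL₂ | hL₂
    · rw [← hL₂, zero_div]; norm_num
    · have hD : 0 < L k₂ * ρ := mul_pos hL₂ hρ0
      calc L k₂ / P k₂ ≤ L k₂ / (L k₂ * ρ) := div_le_div_of_nonneg_left hL₂.le hD (by rw [← hL₁] at hP₂; linarith)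
        _ = 1 / ρ := by field_simp
        _ ≤ 2 := by rw [div_le_iff₀ hρ0]; linarith
  rcases (hL k₂).eq_or_lt with hL₂ | hL₂
  · rw [← hL₂, zero_div, add_zero]
    have hD : 0 < L k₁ * ρ := mul_pos hL₁ hρ0
    calc L k₁ / P k₁ ≤ L k₁ / (L k₁ * ρ) := div_le_div_of_nonneg_left hL₁.le hD (by rw [← hL₂] at hP₁; linarith)
      _ = 1 / ρ := by field_simp
      _ ≤ 2 := by rw [div_le_iff₀ hρ0]; linarith
  -- main case: compare with the rider-free denominators and use the quadratic form
  have hD₁ : 0 < L k₁ * ρ + L k₂ * s := by nlinarith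
  have hD₂ : 0 < L k₁ * s' + L k₂ * ρ := by nlinarith
  have hle : L k₁ / P k₁ + L k₂ / P k₂ ≤ L k₁ / (L k₁ * ρ + L k₂ * s) + L k₂ / (L k₁ * s' + L k₂ * ρ) :=
    add_le_add (div_le_div_of_nonneg_left hL₁.le hD₁ hP₁) (div_le_div_of_nonneg_left hL₂.le hD₂ hP₂)
  refine hle.trans ?_
  rw [div_add_div _ _ hD₁.ne' hD₂.ne', div_le_iff₀ (mul_pos hD₁ hD₂)]
  -- 2 D₁ D₂ − (L₁ D₂ + L₂ D₁) = (2ρ−1)s′L₁² + (2ρ² + 2ss′ − 2ρ)L₁L₂ + (2ρ−1)s L₂² ≥ [(1 + 2ss′ − 2ρ) + 2(2ρ−1)·0.1643]·L₁L₂ ≥ 0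
  have hsq : 2 * (L k₁ * L k₂) ≤ L k₁ * L k₁ + L k₂ * L k₂ := by nlinarith [sq_nonneg (L k₁ - L k₂)]
  have hcoef : 0 ≤ (1 + 2 * (s * s') - 2 * ρ) + 2 * (2 * ρ - 1) * 0.1643 := by nlinarith
  nlinarith [mul_nonneg (mul_nonneg (by linarith : (0:ℝ) ≤ 2 * ρ - 1) (by linarith : (0:ℝ) ≤ s' - 0.1643)) (mul_nonneg hL₁.le hL₁.le),
    mul_nonneg (mul_nonneg (by linarith : (0:ℝ) ≤ 2 * ρ - 1) (by linarith : (0:ℝ) ≤ s - 0.1643)) (mul_nonneg hL₂.le hL₂.le),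
    mul_nonneg hcoef (mul_nonneg hL₁.le hL₂.le),
    mul_nonneg (by linarith : (0:ℝ) ≤ 2 * ρ - 1) (by nlinarith [hsq] : (0:ℝ) ≤ 0.1643 * (L k₁ * L k₁ + L k₂ * L k₂ - 2 * (L k₁ * L k₂)))]

/-- **TWO NEAR AGES WITH A MARKOV RIDER COMPARE AT ANY SIZE**: `B = b + Σ_{k<K} L_k·u_k` with `L ≥ 0` supported on `{0, k₁, k₂}`, `1 ≤ k₁ ≠ k₂ < K`,
`k₂ ≤ 36k₁`, `k₁ ≤ 36k₂`; `B′` with a zeroth moment, `B ≤ B′`, ISOTONE excess: ANY box solutions from one pin satisfy `h′ ≤ h` at every scale ((E58b)).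
[folklore] -/
theorem le_of_isotone_excess_two_ages_markov_near {p : ℝ} (hL : ∀ k, 0 ≤ L k) (hb : 0 < b) (hk₁ : 1 ≤ k₁) (hk₂ : 1 ≤ k₂) (hne : k₁ ≠ k₂)
    (hk₁K : k₁ < K) (hk₂K : k₂ < K) (h12 : k₂ ≤ 36 * k₁) (h21 : k₁ ≤ 36 * k₂)
    (hsupp : ∀ k ∈ range K, k ≠ 0 → k ≠ k₁ → k ≠ k₂ → L k = 0)
    (hB' : ∀ u u' : ℕ → ℝ, SeqBox γ u → SeqBox γ u' → ∀ D : ℝ, (∀ j, |u j - u' j| ≤ D) → |B' u - B' u'| ≤ M' * D) (hM' : 0 ≤ M')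
    (hexc : ∀ u, SeqBox γ u → (fun u : ℕ → ℝ => b + ∑ k ∈ range K, L k * u k) u ≤ B' u)
    (hDmono : ∀ u v : ℕ → ℝ, SeqBox γ u → SeqBox γ v → (∀ j, u j ≤ v j) →
      B' u - (fun u : ℕ → ℝ => b + ∑ k ∈ range K, L k * u k) u ≤ B' v - (fun u : ℕ → ℝ => b + ∑ k ∈ range K, L k * u k) v)
    (hp : 0 < p) (hpγ : p ≤ γ) (hh : SeqBox γ h) (hf : MemFlow (fun u : ℕ → ℝ => b + ∑ k ∈ range K, L k * u k) p h)
    (hh' : SeqBox γ h') (hf' : MemFlow B' p h') (j : ℕ) : h' j ≤ h j :=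
  le_of_isotone_excess_affine_profile hL hb
    (profileSum_le_two_of_two_ages_markov hL hk₁ hk₂ hne (mem_range.mpr hk₁K) (mem_range.mpr hk₂K) h12 h21 hsupp)
    hB' hM' hexc hDmono hp hpγ hh hf hh' hf' j

/-! ## §2 Two far ages with a Markov rider -/

/-- **TWO FAR AGES WITH A MARKOV RIDER COMPARE AT ANY SIZE**: `L ≥ 0` supported on `{0, k₁, k₂}`, `1 ≤ k₁`, `36·k₁ ≤ k₂ < K` — (E63c)'s uniform tower
theorem with `n = 2`, `R = 36` (`3(√2∕2) + 4 ≤ 72·(1 − √2∕2)²`). [folklore] -/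
theorem le_of_isotone_excess_two_ages_markov_far {p : ℝ} (hL : ∀ k, 0 ≤ L k) (hb : 0 < b) (hk₁ : 1 ≤ k₁) (hfar : 36 * k₁ ≤ k₂) (hk₂K : k₂ < K)
    (hsupp : ∀ k ∈ range K, k ≠ 0 → k ≠ k₁ → k ≠ k₂ → L k = 0)
    (hB' : ∀ u u' : ℕ → ℝ, SeqBox γ u → SeqBox γ u' → ∀ D : ℝ, (∀ j, |u j - u' j| ≤ D) → |B' u - B' u'| ≤ M' * D) (hM' : 0 ≤ M')
    (hexc : ∀ u, SeqBox γ u → (fun u : ℕ → ℝ => b + ∑ k ∈ range K, L k * u k) u ≤ B' u)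
    (hDmono : ∀ u v : ℕ → ℝ, SeqBox γ u → SeqBox γ v → (∀ j, u j ≤ v j) →
      B' u - (fun u : ℕ → ℝ => b + ∑ k ∈ range K, L k * u k) u ≤ B' v - (fun u : ℕ → ℝ => b + ∑ k ∈ range K, L k * u k) v)
    (hp : 0 < p) (hpγ : p ≤ γ) (hh : SeqBox γ h) (hf : MemFlow (fun u : ℕ → ℝ => b + ∑ k ∈ range K, L k * u k) p h)
    (hh' : SeqBox γ h') (hf' : MemFlow B' p h') (j : ℕ) : h' j ≤ h j := by
  have hlt : k₁ < k₂ := by omega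
  have hcard : ({k₁, k₂} : Finset ℕ).card = 2 := Finset.card_pair (ne_of_lt hlt)
  refine le_of_isotone_excess_tower_ratio_uniform (A := {k₁, k₂}) (R := 36) hL hb ?_ ?_ ?_ ?_ ?_ hB' hM' hexc hDmono hp hpγ hh hf hh' hf' j
  · intro k hk
    simp only [Finset.mem_insert, Finset.mem_singleton] at hk
    rcases hk with rfl | rfl <;> exact mem_range.mpr (by omega)
  · intro k hk
    simp only [Finset.mem_insert, Finset.mem_singleton] at hk
    rcases hk with rfl | rfl <;> omega
  · intro k hk hkA hk0
    simp only [Finset.mem_insert, Finset.mem_singleton, not_or] at hkA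
    exact hsupp k hk hk0 hkA.1 hkA.2
  · intro k hk k' hk' hkk'
    simp only [Finset.mem_insert, Finset.mem_singleton] at hk hk'
    rcases hk with rfl | rfl <;> rcases hk' with rfl | rfl <;> omega
  · rw [hcard]
    obtain ⟨hlo, _⟩ := one_sub_sqrt_two_div_two_bounds
    push_cast
    nlinarith [pow_le_pow_left₀ (by norm_num : (0:ℝ) ≤ 0.2928) hlo.le 2]

/-! ## §3 Any two ages with any Markov weight -/

/-- **ANY TWO AFFINE AGES WITH ANY MARKOV WEIGHT COMPARE AT ANY SIZE.**  `B(u) = b + L_0·u_0 + L₁·u_{k₁} + L₂·u_{k₂}` on ]0,γ] (`b > 0`; `L ≥ 0` supported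
on `{0, k₁, k₂}` with `1 ≤ k₁ ≠ k₂ < K` — the sizes `L_0, L_{k₁}, L_{k₂}` ARBITRARY); `B′` with zeroth moment `M′ ≥ 0`, `B ≤ B′` on the box, the EXCESS
`B′ − B` ISOTONE; `h`, `h′` ANY box solutions of `B`, `B′` from one pin `p ∈ ]0,γ]`.  Then `h′ ≤ h` at EVERY scale: ratio `≥ 36` either way — §2; otherwise
both ratios `≤ 36` — §1.  (E59e) `le_of_isotone_excess_two_ages` is the case `L_0 = 0`. [folklore] -/
theorem le_of_isotone_excess_two_ages_markov {p : ℝ} (hL : ∀ k, 0 ≤ L k) (hb : 0 < b) (hk₁ : 1 ≤ k₁) (hk₂ : 1 ≤ k₂) (hne : k₁ ≠ k₂)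
    (hk₁K : k₁ < K) (hk₂K : k₂ < K) (hsupp : ∀ k ∈ range K, k ≠ 0 → k ≠ k₁ → k ≠ k₂ → L k = 0)
    (hB' : ∀ u u' : ℕ → ℝ, SeqBox γ u → SeqBox γ u' → ∀ D : ℝ, (∀ j, |u j - u' j| ≤ D) → |B' u - B' u'| ≤ M' * D) (hM' : 0 ≤ M')
    (hexc : ∀ u, SeqBox γ u → (fun u : ℕ → ℝ => b + ∑ k ∈ range K, L k * u k) u ≤ B' u)
    (hDmono : ∀ u v : ℕ → ℝ, SeqBox γ u → SeqBox γ v → (∀ j, u j ≤ v j) →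
      B' u - (fun u : ℕ → ℝ => b + ∑ k ∈ range K, L k * u k) u ≤ B' v - (fun u : ℕ → ℝ => b + ∑ k ∈ range K, L k * u k) v)
    (hp : 0 < p) (hpγ : p ≤ γ) (hh : SeqBox γ h) (hf : MemFlow (fun u : ℕ → ℝ => b + ∑ k ∈ range K, L k * u k) p h)
    (hh' : SeqBox γ h') (hf' : MemFlow B' p h') (j : ℕ) : h' j ≤ h j := by
  by_cases hfar : 36 * k₁ ≤ k₂
  · exact le_of_isotone_excess_two_ages_markov_far hL hb hk₁ hfar hk₂K hsupp hB' hM' hexc hDmono hp hpγ hh hf hh' hf' j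
  by_cases hfar' : 36 * k₂ ≤ k₁
  · have hsupp' : ∀ k ∈ range K, k ≠ 0 → k ≠ k₂ → k ≠ k₁ → L k = 0 := fun k hk h0 h2 h1 => hsupp k hk h0 h1 h2
    exact le_of_isotone_excess_two_ages_markov_far hL hb hk₂ hfar' hk₁K hsupp' hB' hM' hexc hDmono hp hpγ hh hf hh' hf' j
  · exact le_of_isotone_excess_two_ages_markov_near hL hb hk₁ hk₂ hne hk₁K hk₂K (not_le.mp hfar).le (not_le.mp hfar').le hsupp
      hB' hM' hexc hDmono hp hpγ hh hf hh' hf' j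

end Summit.QuantumFields.BalabanUV.Beta.EriceRemainderEnclosureHistoryAutonomyComparisonTwoAgesMarkov

end
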